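import Literature.AnabelianGeometry.SemiGraphs.PSCSeparatingCoveringsUnrConsumers
import HarnessLib

/-!
# [CombGC] Prop. 1.2 (i)(ii) over an origin (rows F-0459, F-0438): the separating-coverings input shrunk to its EDGE-LIKE third

Mochizuki, *A combinatorial version of the Grothendieck conjecture*, Tohoku Math. J. **59** (2007)
[CombGC], Proposition 1.2 (Commensurable Terminality), author's manuscript p. 8: "(i) If `A₁ ∩ A₂` is open
in `A₁`, then `v₁ = v₂` (respectively, `e₁ = e₂`) … (ii) The `Aᵢ` (respectively, `Bᵢ`) are commensurably
terminal in `Π_G` (respectively, `Π^unr_G`)", proved on p. 9 from separating finite étale coverings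
[cite: MochizukiCombGC2007, Prop 1.2 pp.8-9].

PROOF-ONLY capstone (abc-iut cell, block F, seat abc-iut-f-166; FACT-LIST rows F-0459
`OpenInterDeterminesComponentHolds`, F-0438 `CommensurableTerminalityHolds`, and the sub-DAG input
P12-L01 = rows F-2826/F-2827/F-2828, conjunction F-2829, origin form F-2830).  abc-iut-w5-d183's P12-L00
(`openInterDeterminesComponentHolds_of_separating`, `commensurableTerminalityHolds_of_separating`) derives
the printed Prop. 1.2 (i)/(ii) over `Ω` from the WHOLE separating-coverings statement
`SeparatingCoveringsHolds Ω` (three thirds: verticial, edge-like, unramified) + profiniteness.  Two of the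
three thirds are now DERIVED from the [IUTchI] Rmk. 1.2.3 (iv) family at covering data — the verticial
third by abc-iut-f-165 (`verticialSeparatingCoverings_of_origin_frozen`), the unramified third at the
`Π^unr`-levels its consumers use (`PSCSeparatingCoveringsUnrOfVertexQuotients`,
`PSCSeparatingCoveringsUnrConsumers`).  Hence:

* `prop12_of_edgeLikeThird_of_origin_frozen` — all five typed clauses of Prop. 1.2 (i)(ii) for an
  `Ω`-datum `G`, from the named inputs `RestrictBDOfPSCTypeHolds Ω`, `SturdyCoverHolds Ω` ([CombGC]
  Rmk. 1.1.5), `UnrVerticialCharacterizationHolds Ω` ([IUTchI] Rmk. 1.2.3 (iv), frozen F-1938),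
  `UnrVertAbOfRankHolds Ω` (Rmk. 1.1.5), profiniteness, and ONLY the edge-like third
  `G.EdgeLikeSeparatingCoverings` (row F-2827) of the separating-coverings input;
* `openInterDeterminesComponentHolds_of_edgeLikeThird` (row F-0459) and
  `commensurableTerminalityHolds_of_edgeLikeThird` (row F-0438) — the printed Prop. 1.2 (i) and (ii)
  over `Ω` from those named inputs + the edge-like third at every `Ω`-datum (displayed) — in place of
  `SeparatingCoveringsHolds Ω`.

What remains origin-level for the node `CombGC:Prop1.2` is exactly F-2827 (abc-iut-f-165's census: it
needs the structure of the edge module `M^edge`, [CombGC] Prop. 1.3, which the tree does not type).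
0 definitions; typed ≠ proved for the inputs; a FACT row is an assumption label; nothing here takes a
side on [IUTchIII] Cor. 3.12.
-/

noncomputable section

namespace Literature.AnabelianGeometry.SemiGraphs

namespace PSCDatum

open scoped Pointwise

universe u

variable (Ω : PSCOrigin.{u})

/-- **[CombGC] Prop. 1.2 (i)(ii), all five typed clauses, for an `Ω`-datum**, from the named
origin statements and ONLY the edge-like third (row F-2827) of the separating-coverings input: the
verticial third is abc-iut-f-165's `verticialSeparatingCoverings_of_origin_frozen`, the unramified
clauses are `unrVerticialOpenInterDeterminesVertex_of_origin_frozen` /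
`unrVerticialCommensurablyTerminal_of_origin_frozen`, the rest abc-iut-w5-d183's P12-L02/L03.
[cite: MochizukiCombGC2007, Prop 1.2 pp.8-9] -/
theorem prop12_of_edgeLikeThird_of_origin_frozen (hres : RestrictBDOfPSCTypeHolds Ω)
    (hstc : SturdyCoverHolds Ω) (hunr : UnrVerticialCharacterizationHolds Ω)
    (hrank : UnrVertAbOfRankHolds Ω)
    (hprof : ∀ ⦃Q : Type u⦄ [Group Q] [TopologicalSpace Q] [IsTopologicalGroup Q] (G : PSCDatum Q),
      Ω.IsOfPSCType G → CompactSpace Q ∧ TotallyDisconnectedSpace Q)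
    {Q : Type u} [Group Q] [TopologicalSpace Q] [IsTopologicalGroup Q] (G : PSCDatum Q)
    (hG : Ω.IsOfPSCType G) (hE : G.EdgeLikeSeparatingCoverings) :
    (G.VerticialOpenInterDeterminesVertex ∧ G.EdgeLikeOpenInterDeterminesEdge ∧
      G.UnrVerticialOpenInterDeterminesVertex) ∧
    (G.VerticialEdgeLikeCommensurablyTerminal ∧ G.UnrVerticialCommensurablyTerminal) := by
  obtain ⟨hc, htd⟩ := hprof G hG
  have hV : G.VerticialSeparatingCoverings :=
    verticialSeparatingCoverings_of_origin_frozen Ω hres hstc hunr hrank hprof G hG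
  exact ⟨⟨G.verticialOpenInterDeterminesVertex_of_separating hV,
      G.edgeLikeOpenInterDeterminesEdge_of_separating hE,
      unrVerticialOpenInterDeterminesVertex_of_origin_frozen Ω hres hunr hrank hprof G hG⟩,
    ⟨G.verticialEdgeLikeCommensurablyTerminal_of_separating hV hE,
      unrVerticialCommensurablyTerminal_of_origin_frozen Ω hres hunr hrank hprof G hG⟩⟩

/-- **Row F-0459, [CombGC] Prop. 1.2 (i) as printed** (`OpenInterDeterminesComponentHolds Ω`), from the
named origin statements `RestrictBDOfPSCTypeHolds Ω`, `SturdyCoverHolds Ω`,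
`UnrVerticialCharacterizationHolds Ω` (F-1938), `UnrVertAbOfRankHolds Ω`, profiniteness of the `Π_G` of
`Ω`-data, and the EDGE-LIKE third of the separating-coverings input at every `Ω`-datum (displayed) — in
place of the whole `SeparatingCoveringsHolds Ω` of abc-iut-w5-d183's P12-L00.
[cite: MochizukiCombGC2007, Prop 1.2(i) p.8] -/
theorem openInterDeterminesComponentHolds_of_edgeLikeThird (hres : RestrictBDOfPSCTypeHolds Ω)
    (hstc : SturdyCoverHolds Ω) (hunr : UnrVerticialCharacterizationHolds Ω)
    (hrank : UnrVertAbOfRankHolds Ω)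
    (hprof : ∀ ⦃Q : Type u⦄ [Group Q] [TopologicalSpace Q] [IsTopologicalGroup Q] (G : PSCDatum Q),
      Ω.IsOfPSCType G → CompactSpace Q ∧ TotallyDisconnectedSpace Q)
    (hE : ∀ ⦃Q : Type u⦄ [Group Q] [TopologicalSpace Q] [IsTopologicalGroup Q] (G : PSCDatum Q),
      Ω.IsOfPSCType G → G.EdgeLikeSeparatingCoverings) :
    OpenInterDeterminesComponentHolds Ω := by
  intro Q _ _ _ G hG
  exact (prop12_of_edgeLikeThird_of_origin_frozen Ω hres hstc hunr hrank hprof G hG (hE G hG)).1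

/-- **Row F-0438, [CombGC] Prop. 1.2 (ii) as printed** (`CommensurableTerminalityHolds Ω`), from the
same named origin statements and the edge-like third at every `Ω`-datum (displayed) — in place of the
whole `SeparatingCoveringsHolds Ω`. [cite: MochizukiCombGC2007, Prop 1.2(ii) p.8] -/
theorem commensurableTerminalityHolds_of_edgeLikeThird (hres : RestrictBDOfPSCTypeHolds Ω)
    (hstc : SturdyCoverHolds Ω) (hunr : UnrVerticialCharacterizationHolds Ω)
    (hrank : UnrVertAbOfRankHolds Ω)
    (hprof : ∀ ⦃Q : Type u⦄ [Group Q] [TopologicalSpace Q] [IsTopologicalGroup Q] (G : PSCDatum Q),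
      Ω.IsOfPSCType G → CompactSpace Q ∧ TotallyDisconnectedSpace Q)
    (hE : ∀ ⦃Q : Type u⦄ [Group Q] [TopologicalSpace Q] [IsTopologicalGroup Q] (G : PSCDatum Q),
      Ω.IsOfPSCType G → G.EdgeLikeSeparatingCoverings) :
    CommensurableTerminalityHolds Ω := by
  intro Q _ _ _ G hG
  exact (prop12_of_edgeLikeThird_of_origin_frozen Ω hres hstc hunr hrank hprof G hG (hE G hG)).2

/-- In particular (sanity / monotonicity): the whole `SeparatingCoveringsHolds Ω` is no longer needed for
rows F-0459/F-0438 once the named inputs are bound — its edge-like third suffices.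
[cite: MochizukiCombGC2007, Prop 1.2 pp.8-9] -/
theorem prop12Holds_of_separatingCoveringsHolds_edgeLikeThird (hres : RestrictBDOfPSCTypeHolds Ω)
    (hstc : SturdyCoverHolds Ω) (hunr : UnrVerticialCharacterizationHolds Ω)
    (hrank : UnrVertAbOfRankHolds Ω)
    (hprof : ∀ ⦃Q : Type u⦄ [Group Q] [TopologicalSpace Q] [IsTopologicalGroup Q] (G : PSCDatum Q),
      Ω.IsOfPSCType G → CompactSpace Q ∧ TotallyDisconnectedSpace Q)
    (hsep : SeparatingCoveringsHolds Ω) :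
    OpenInterDeterminesComponentHolds Ω ∧ CommensurableTerminalityHolds Ω :=
  ⟨openInterDeterminesComponentHolds_of_edgeLikeThird Ω hres hstc hunr hrank hprof
      (fun _ _ _ _ G hG => (hsep G hG).2.1),
    commensurableTerminalityHolds_of_edgeLikeThird Ω hres hstc hunr hrank hprof
      (fun _ _ _ _ G hG => (hsep G hG).2.1)⟩

end PSCDatum

end Literature.AnabelianGeometry.SemiGraphs

end
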